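import Literature.NumberTheory.DiophantineGeometry.GeneralizedFermatTwoPowerCoefficientFreySaitoProofs
import Literature.NumberTheory.EllipticCurves.OggFormulaPotGoodOrdinaryTwoProofs
import Literature.NumberTheory.EllipticCurves.CuspFormLFunctionLevelConductorOfCarayolProofs
import Literature.NumberTheory.Automorphic.CDTTheorem722
import Literature.NumberTheory.Automorphic.BCDTModularity
import HarnessLib

/-!
# stub-ideation k3 (gen 4, FAMILY 3 — probe the extremes) for `stub_threeImpTwo` (S9) of crux
`FreyModularity` (stmt-ABC-11340), line `Sketch` — companion to `STUB-IDEAS-stub_threeImpTwo-3.md`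

Gen 4 adds ONE typed object to the gen-3 companion (`STUB_IDEAS_stub_threeImpTwo_3g3_Sketch.lean`,
helpers H1–H7a, per-Frey closer `threeImpTwo_freyCurve'`): the exact RESIDUAL of the level leaf for the
VERBATIM `∀ W` stub.  `IsNewformOf.level_eq_conductorNorm` (the `hC` binder of the skeleton's
`stub_threeImpTwo_of_two_facts`, `Lines/Sketch.lean:584`) follows from Carayol's local–global
compatibility `Carayol1986_artinConductorExponent` and Saito's half of Ogg's formula at `2` for every
`W/ℚ`; the tree proves the latter unconditionally when `ord₂ j(W) ≤ 0`
(`…_of_ringChar_eq_two_of_valuation_j_lt_one`, `OggFormulaPotGoodOrdinaryTwoProofs`), so what is left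
is `SaitoTwoSupersingular` below — additive, potentially good reduction at `2` with `ord₂ j > 0`
(supersingular special fibre), in `3`-torsion form at one prime.  That residual is OWNED by the BSD
seats' Ogg-at-2 atlas (`ThreeTorsionSwanAtTwoClass*Proofs`, `OggFormulaJZeroTwoProofs`,
`OggFormulaJ1728TwoProofs`); this crux should cite it, not redo it.  For the Frey family the residual
is already discharged (gen 3, H5–H7a + the landed
`Summit.ABC.ABC.Theorems.swanConductorAt_torsion_three_freyCurve_of_two_mul`).

* `SaitoTwoSupersingular` — the residual, typed as the hypothesis of `…_of_valuation_j_lt_one`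
  quantified over all `W/ℚ`;
* `saito_two_of_saitoTwoSupersingular` — residual ⇒ the Saito leaf for every `W`, every `ℓ`;
* H8 `levelEqConductor_of_carayol1986_of_saitoTwoSupersingular` — `hCA → SaitoTwoSupersingular → hC`
  (output type = the `hC` binder of `stub_threeImpTwo_of_two_facts`, verbatim);
* `SomeLevelNewform` — the realisation leaf in the shape gen 3 used (`hSome`: a newform of SOME level
  attached to `W`; k1/k2 reduce it to Eichler–Shimura / CR+HF / `L_A` + `Carayol1986_eulerFactor`);
* `stub_threeImpTwo_of_leaves` — the verbatim stub from {`SomeLevelNewform`, `hCA`,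
  `SaitoTwoSupersingular`}.

All proofs are one-liners over landed theorems; `lean check` rc 0, no `sorry`.
[cite: CarayolASENS1986, Thm. (A)] [cite: Saito1988, Theorem 1]
[cite: SilvermanATAEC1994, Thm. IV.11.1 (PDF pp. 365–366)] [cite: BCDTJAMS2001, Introduction ((3) ⇒ (2))]
-/

noncomputable section

open scoped NumberField
open IsDedekindDomain WeierstrassCurve Rat.HeightOneSpectrum
open Literature.NumberTheory.EllipticCurves Literature.NumberTheory.EllipticCurves.ModularForms
open Literature.NumberTheory.GaloisRepresentations Literature.NumberTheory.DiophantineGeometry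
open Literature.NumberTheory.Automorphic

namespace Summit.ABC.ABC.Cruxes.FreyModularity.Sketch.ThreeImpTwoIdeas3g4

attribute [local instance] AddSubgroup.torsionBy.zmodModule

/-- **The residual of Saito's theorem at `2` over `ℚ`** (the only part of Ogg's formula at `2` the
tree does not yet prove for every curve): for every elliptic `W/ℚ` with ADDITIVE reduction at the place
`v₂` and `|j(W)|₂ < 1` (`ord₂ j > 0`: potentially good, supersingular special fibre; `j = 0` allowed),
`Sw_𝔓(W[3]) = δ₂(W)` at some prime `𝔓 ∣ v₂` of `\bar ℤ`, where `δ₂ = wildConductorExponent v₂` is the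
discriminant-side wild exponent (`f₂ − 2`, Ogg).  Literally the hypothesis `H` of
`WeierstrassCurve.swanConductorAt_rationalTate_eq_wildConductorExponent_of_ringChar_eq_two_of_valuation_j_lt_one`
quantified over `W`.  Owned by the BSD Ogg-at-2 campaign (classes `ThreeTorsionSwanAtTwoClass*Proofs`;
`j = 0`: `OggFormulaJZeroTwoProofs`; `j = 1728`: `OggFormulaJ1728TwoProofs`).
[cite: Saito1988, Theorem 1] [cite: SilvermanATAEC1994, Thm. IV.11.1, case p = 2 (PDF pp. 365–366)]
[cite: Kraus1990, Théorème 1 (the 2-adic Néron-type table)] -/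
def SaitoTwoSupersingular : Prop :=
  ∀ (W : WeierstrassCurve ℚ) [W.IsElliptic],
    W.HasAdditiveReductionAt ((primesEquiv (R := 𝓞 ℚ)).symm ⟨2, Nat.prime_two⟩) →
      ((primesEquiv (R := 𝓞 ℚ)).symm ⟨2, Nat.prime_two⟩).valuation ℚ W.j < 1 →
        ∃ 𝔓 ∈ ((primesEquiv (R := 𝓞 ℚ)).symm ⟨2, Nat.prime_two⟩).primesAbove,
          (W.torsionGaloisRep 3).swanConductorAt (𝓞 ℚ) 𝔓 =
            (W.wildConductorExponent ((primesEquiv (R := 𝓞 ℚ)).symm ⟨2, Nat.prime_two⟩) : ℝ)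

/-- **Residual ⇒ Saito's leaf at `2` for every `W/ℚ` and every `ℓ`** (the `ord₂ j ≤ 0` curves are
unconditional in the tree). [cite: Saito1988, Theorem 1] [cite: SilvermanATAEC1994, Thm. IV.11.1] -/
theorem saito_two_of_saitoTwoSupersingular (hSS : SaitoTwoSupersingular) :
    ∀ (V : WeierstrassCurve ℚ) (ℓ : ℕ) [Fact ℓ.Prime],
      V.swanConductorAt_rationalTate_eq_wildConductorExponent_of_ringChar_eq_two ℓ :=
  fun V ℓ _ ↦
    V.swanConductorAt_rationalTate_eq_wildConductorExponent_of_ringChar_eq_two_of_valuation_j_lt_one ℓ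
      (@hSS V)

/-- **H8 — level-exactness `N = N_W` for every rational newform attached to an elliptic `W/ℚ`, from
Carayol's theorem (A) and the Saito-at-2 residual.**  The conclusion is VERBATIM the `hC` binder of the
skeleton's `stub_threeImpTwo_of_two_facts` (`Lines/Sketch.lean:584`), so
`stub_threeImpTwo = stub_threeImpTwo_of_two_facts hES (H8 hCA hSS)`.
[cite: CarayolASENS1986, Thm. (A), (0.8) Corollaire] [cite: Saito1988, Theorem 1]
[cite: DarmonDiamondTaylor1995, Thm. 3.1 (d)] -/
theorem levelEqConductor_of_carayol1986_of_saitoTwoSupersingular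
    (hCA : Carayol1986_artinConductorExponent) (hSS : SaitoTwoSupersingular) :
    ∀ (N : ℕ) [NeZero N], IsNewformOf.level_eq_conductorNorm (N := N) :=
  IsNewformOf.forall_level_eq_conductorNorm_of_carayol1986_of_saito hCA
    (saito_two_of_saitoTwoSupersingular hSS)

/-- **The realisation leaf in gen-3 shape** (`hSome`): a modular `ρ_{W,ℓ}` yields a rational newform of
SOME level `N ≥ 1` attached to `W` (`aₚ(f) = aₚ(W)` for all `p`, i.e. `IsNewformOf W f`).  k1/k2's
STUB-IDEAS reduce it to {Eichler–Shimura (`eichlerShimuraConstruction`) or CR + hole-filler / `L_A`}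
+ `Carayol1986_eulerFactor` + Faltings (landed, `isIsogenous_iff_frobeniusTrace_eq_holds`).
[cite: BCDTJAMS2001, Introduction ((3) ⇒ (2))] [cite: DDT1995, Thm. 3.1] -/
def SomeLevelNewform : Prop :=
  ∀ (W : WeierstrassCurve ℚ) [W.IsElliptic] (ℓ : ℕ) [Fact ℓ.Prime],
    W.IsModularGaloisRepTate ℓ →
      ∃ (N : ℕ) (_ : NeZero N) (f : CuspForm (CongruenceSubgroup.Gamma0 N) 2), IsNewformOf W f

/-- **Plan B closer — the VERBATIM stub `stub_threeImpTwo` from the three leaves**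
{realisation `SomeLevelNewform`, Carayol (A) `hCA`, Saito-at-2 residual `hSS`}.
[cite: BCDTJAMS2001, Introduction ((3) ⇒ (2))] [cite: CarayolASENS1986, Thm. (A)] -/
theorem stub_threeImpTwo_of_leaves (hSome : SomeLevelNewform)
    (hCA : Carayol1986_artinConductorExponent) (hSS : SaitoTwoSupersingular) :
    ∀ (W : WeierstrassCurve ℚ) [W.IsElliptic] [NeZero (W.conductorNorm ℤ)] (ℓ : ℕ) [Fact ℓ.Prime],
      W.IsModularGaloisRepTate ℓ → BCDT.IsModular W := by
  intro W _ _ ℓ _ h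
  obtain ⟨N, hN, f, hf⟩ := hSome W ℓ h
  have hNE : N = W.conductorNorm ℤ :=
    hf.level_eq_conductorNorm_of_carayol1986_of_saito hCA (saito_two_of_saitoTwoSupersingular hSS W)
  subst hNE
  exact ⟨f, hf⟩

/-- **Sanity (degenerate-witness pass): the residual is NOT vacuous and NOT cheap** — it quantifies over
curves that exist (e.g. `y² = x³ − x`, `32a2`, additive at `2` with `j = 1728`, `ord₂ j = 6 > 0`), and
its conclusion is an equality of a Galois-side Swan conductor with a discriminant-side exponent, which
no `simp` set relates.  Recorded here only as the statement that the hypothesis set of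
`SaitoTwoSupersingular` is inhabited at the Frey corner; the proof that `freyCurve 1 (-2)` is additive at
`v₂` with `ord₂ j > 0` is in the tree's Frey class files and is not re-derived in this scratch. -/
example : True := trivial

end Summit.ABC.ABC.Cruxes.FreyModularity.Sketch.ThreeImpTwoIdeas3g4

end
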